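import Summits.BirchSwinnertonDyer.BirchSwinnertonDyer.Theorems.AdditiveBranchIMCTwistRootNumberAnyTwo
import Literature.NumberTheory.EllipticCurves.QuadraticTwistTateFormTwoProofs
import HarnessLib

/-!
# The conductor of `E^{(2ℓ)}` prime by prime for `E` MULTIPLICATIVE at `2` — odd additive primes of quadratic-twist type
# (crux `AdditiveBranchIMC.GordTwoRankOne`, line `wan_tame_bdp_road` v23, conductor half of stub `stub_rootNumberDyadicWan : EngineTwo`)

Theorems-side sequel (theorems only; no definition, no named fact, no `sorry`) of p758088 `AdditiveBranchIMCTwistConductorAnyTwo`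
(the conductor of `E^{(qℓ)}` for an ODD prime `q`, `qℓ ≡ 1 (mod 8)`), now with `2` ITSELF as the twisting prime: `E / ℚ` (globally minimal
`W`) whose ODD additive primes are of quadratic-twist type (`htt`), MULTIPLICATIVE at `2`, `ℓ ≥ 5` good, `W' = E^{(2ℓ)}`:

* `conductorExponent_quadraticTwist_eq_six_of_hasMultiplicativeReductionAtPrime_two` — **`f₂(E^{(d)}) = 6`** for `E` multiplicative at
  `2` and `d ≡ 2 (mod 4)`: Tate normal form `E ≅ T^{(d₀)}`, `d₀ ≡ 1 (mod 4)` forced by `f₂(E) = 1`, `E^{(d)} ≅ T^{(d₀d)}` with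
  `d₀d ≡ 2 (mod 4)`, Ogg's formula on Kodaira `I*_{ν+8}` (`QuadraticTwistTateFormTwoProofs.conductorExponent_eq_six_of_emod_four_eq_two`;
  the pattern of `maninLocalTwoThree_pow_dvd_conductorNorm_quadraticTwist_of_mult_two`);
* `hasReductionAt_quadraticTwist_two_mul_iff`, `conductorExponent_quadraticTwist_two_mul_eq` — away from `2, ℓ` the reduction types and
  the exponents of `W'` and `W` agree (`2ℓ` an `r`-adic unit; at an odd additive prime both are `2`, twist type transported);
* `conductorNorm_quadraticTwist_two_mul_eq` — **`N_{W'} = 32 · N_W · ℓ²`** (`f₂ : 1 ↦ 6`, `f_ℓ : 0 ↦ 2`);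
* `conductorExponent_pStar_quadraticTwist_two_mul_le` — the bound `f_v(W'^{(p*)}) ≤ f_v(W')` at the additive `v ≠ p` of `W'` for every odd
  prime `p` (hypothesis `hle` of `atkinLehnerEigenvalueAt_eq_χ₄_of_twist_of_le`), including `v = 2` (`p* ≡ 1 (mod 4)` does not move `f₂`).

The root-number identity `w(E^{(2ℓ)}) = w(E)` itself is `AdditiveBranchIMCTwistRootNumberDyadic`. BSD is proved for no curve by any of this.
References: [SilvermanATAEC1994] IV.9.4, IV.10.2, IV.11.1 and Table 4.1; [SilvermanAEC2009] VII.5 Prop. 5.1, X.5 Cor. 5.4.1.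
-/

set_option linter.dupNamespace false
set_option autoImplicit false

noncomputable section

open scoped Classical

open Literature.NumberTheory.EllipticCurves Literature.NumberTheory.EllipticCurves.ModularForms
  IsDedekindDomain IsDedekindDomain.HeightOneSpectrum NumberField Rat.HeightOneSpectrum WeierstrassCurve
  Summit.BirchSwinnertonDyer.BirchSwinnertonDyer.Theorems
  Summit.BirchSwinnertonDyer.BirchSwinnertonDyer.Theorems.TwistRootNumberAnyTwo

namespace Summit.BirchSwinnertonDyer.BirchSwinnertonDyer.Theorems.TwistRootNumberDyadic

/-- `natGenerator` of the place of `ℤ` under a prime `p` is `p` (the tree's `Rat.natGenerator_primesEquiv_symm`). [folklore] -/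
private theorem natGenerator_symm' (p : Nat.Primes) : natGenerator ((primesEquiv (R := ℤ)).symm p) = p :=
  Literature.NumberTheory.EllipticCurves.Rat.natGenerator_primesEquiv_symm p

/-! ### §1 `f₂(E^{(d)}) = 6` for `E` multiplicative at `2` and `d ≡ 2 (mod 4)` (Tate normal form, Kodaira `I*_{ν+8}`) -/

/-- **`f₂(E^{(d)}) = 6` for `E / ℚ` MULTIPLICATIVE at `2` and `d ≡ 2 (mod 4)`** (e.g. `d = 2ℓ`, `ℓ` odd): via the Tate normal form
`T = tateFormOfJ j`, `E ≅ T^{(d₀)}` with `4 ∤ d₀` (`exists_int_variableChange_eq_quadraticTwist_tateFormOfJ`), `f₂(E) = 1` rules out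
`d₀ ≡ 2, 3 (mod 4)` (`f₂ = 6, 4`), so `d₀ ≡ 1 (mod 4)` and `E^{(d)} ≅ T^{(d₀d)}`, `d₀d ≡ 2 (mod 4)`: Ogg's formula on Kodaira `I*_{ν+8}`
(`conductorExponent_eq_six_of_emod_four_eq_two`). The pattern of `maninLocalTwoThree_pow_dvd_conductorNorm_quadraticTwist_of_mult_two`.
[cite: SilvermanATAEC1994, IV.11.1 (Ogg's formula) and Table 4.1] [cite: SilvermanAEC2009, X.5 Cor. 5.4.1] -/
theorem conductorExponent_quadraticTwist_eq_six_of_hasMultiplicativeReductionAtPrime_two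
    (W : WeierstrassCurve ℚ) [W.IsElliptic] {d : ℤ} (hd4 : d % 4 = 2) [(W.quadraticTwist (d : ℚ)).IsElliptic]
    (hmult : W.HasMultiplicativeReductionAtPrime 2) :
    (W.quadraticTwist (d : ℚ)).conductorExponent ((primesEquiv (R := ℤ)).symm ⟨2, Nat.prime_two⟩) = 6 := by
  set P2 : Nat.Primes := ⟨2, Nat.prime_two⟩ with hP2
  set v : HeightOneSpectrum (𝓞 ℚ) := (primesEquiv (R := 𝓞 ℚ)).symm P2 with hvdef
  have hvP : primesEquiv v = P2 := by rw [hvdef, Equiv.apply_symm_apply]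
  have hv2 : ((primesEquiv v : Nat.Primes) : ℕ) = 2 := by rw [hvP]
  have hv : natGenerator v = 2 := hv2
  haveI := perfectField_residueField_adicCompletionIntegers (K := ℚ) v
  have hdne : d ≠ 0 := by omega
  have hd0 : (d : ℚ) ≠ 0 := by exact_mod_cast hdne
  set V : WeierstrassCurve ℚ := W.quadraticTwist (d : ℚ) with hVdef
  haveI : Fact (Nat.Prime ((primesEquiv v : Nat.Primes) : ℕ)) := ⟨(primesEquiv v).2⟩
  have hmult' : W.HasMultiplicativeReductionAtPrime ((primesEquiv v : Nat.Primes) : ℕ) := by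
    have h : ∀ (q : ℕ) [Fact q.Prime], q = 2 → W.HasMultiplicativeReductionAtPrime q := by
      intro q _ hq; subst hq; exact hmult
    exact h _ hv2
  have hmv : W.HasMultiplicativeReductionAt v :=
    (W.hasMultiplicativeReductionAtPrime_iff_hasMultiplicativeReductionAt_ringOfIntegers v).mp hmult'
  have hj : 1 < v.valuation ℚ W.j := one_lt_valuation_j_of_hasMultiplicativeReduction_localMinimalModel v W hmv
  obtain ⟨hj0, hj1728, -⟩ := j_ne_and_valuation_j_sub_eq_of_one_lt_valuation_j v W hj
  obtain ⟨d₀, -, hd₀4, C₀, hC₀⟩ := W.exists_int_variableChange_eq_quadraticTwist_tateFormOfJ hj0 hj1728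
  have h1 : d₀ % 4 = 1 := by
    have hcases : d₀ % 4 = 1 ∨ d₀ % 4 = 2 ∨ d₀ % 4 = 3 := by omega
    rcases hcases with h | h | h
    · exact h
    · have h6 := (conductorExponent_eq_six_of_emod_four_eq_two v hv W hj h hC₀).1
      have hf1 : W.conductorExponent v = 1 := (conductorExponent_eq_one_iff_holds v W).mpr hmv
      omega
    · have h4 := (conductorExponent_eq_four_of_emod_four_eq_three v hv W hj h hC₀).1
      have hf1 : W.conductorExponent v = 1 := (conductorExponent_eq_one_iff_holds v W).mpr hmv
      omega
  have hjV : V.j = W.j := W.j_quadraticTwist hd0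
  have hW : W = C₀⁻¹ • (tateFormOfJ W.j).quadraticTwist (d₀ : ℚ) := by rw [← hC₀, inv_smul_smul]
  have h2 : V = (C₀⁻¹ • (tateFormOfJ W.j).quadraticTwist (d₀ : ℚ)).quadraticTwist (d : ℚ) :=
    congrArg (fun X : WeierstrassCurve ℚ => X.quadraticTwist (d : ℚ)) hW
  set C₁ : VariableChange ℚ := ⟨C₀⁻¹.u, (d : ℚ) * C₀⁻¹.r, 0, 0⟩ with hC₁
  have hC' : C₁⁻¹ • V = (tateFormOfJ V.j).quadraticTwist ((d₀ * d : ℤ) : ℚ) := by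
    rw [hjV, h2, quadraticTwist_smul, quadraticTwist_quadraticTwist, ← hC₁, inv_smul_smul, Int.cast_mul]
  have hjV' : 1 < v.valuation ℚ V.j := by rw [hjV]; exact hj
  have hdd : (d₀ * d) % 4 = 2 := by rw [Int.mul_emod, h1, hd4]; norm_num
  have h6 := (conductorExponent_eq_six_of_emod_four_eq_two v hv V hjV' hdd hC').1
  rw [conductorExponent_ringOfIntegers_eq V v, hvP] at h6
  exact h6

/-! ### §2 The conductor of `E^{(2ℓ)}` prime by prime — odd additive primes of twist type, `2` multiplicative -/

section Conductor

variable (W : WeierstrassCurve ℚ) [W.IsElliptic]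
  (htt : ∀ p : Nat.Primes, (p : ℕ) ≠ 2 → W.HasAdditiveReductionAt ((primesEquiv (R := ℤ)).symm p) →
    ¬ (W.quadraticTwist (((-1 : ℤ) ^ ((p : ℕ) / 2) * p : ℤ) : ℚ)).HasAdditiveReductionAt ((primesEquiv (R := ℤ)).symm p))
  {ℓ : ℕ} [hℓ : Fact ℓ.Prime]

/-- **Away from `2, ℓ` the reduction types of `E^{(2ℓ)}` and `E` agree**: at an odd prime `p ≠ ℓ` the twist is by a `p`-adic unit.
[cite: SilvermanAEC2009, VII.5 Prop. 5.1] -/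
theorem hasReductionAt_quadraticTwist_two_mul_iff (p : Nat.Primes) (hp2 : (p : ℕ) ≠ 2) (hpℓ : p ≠ ⟨ℓ, hℓ.out⟩) :
    ((W.quadraticTwist (((2 : ℤ) * ℓ : ℤ) : ℚ)).HasGoodReductionAt ((primesEquiv (R := ℤ)).symm p) ↔
        W.HasGoodReductionAt ((primesEquiv (R := ℤ)).symm p)) ∧
      ((W.quadraticTwist (((2 : ℤ) * ℓ : ℤ) : ℚ)).HasMultiplicativeReductionAt ((primesEquiv (R := ℤ)).symm p) ↔
        W.HasMultiplicativeReductionAt ((primesEquiv (R := ℤ)).symm p)) ∧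
      ((W.quadraticTwist (((2 : ℤ) * ℓ : ℤ) : ℚ)).HasAdditiveReductionAt ((primesEquiv (R := ℤ)).symm p) ↔
        W.HasAdditiveReductionAt ((primesEquiv (R := ℤ)).symm p)) := by
  have hp2' : p ≠ ⟨2, (Fact.out : Nat.Prime 2)⟩ := fun h ↦ hp2 (congrArg Subtype.val h)
  have h := not_natGenerator_dvd_mul (q := 2) (ℓ := ℓ) p hp2' hpℓ
  exact W.hasReductionAt_quadraticTwist_iff_of_not_dvd _ (by rw [natGenerator_symm']; exact hp2) (by exact_mod_cast h)

include htt

/-- **`f_p(E^{(2ℓ)}) = f_p(E)` at every odd prime `p ≠ ℓ`**: good / multiplicative types agree; at an odd additive prime both exponents are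
`2` (quadratic-twist type, transported to the twist). [cite: SilvermanATAEC1994, IV.9.4 and IV.10.2] -/
theorem conductorExponent_quadraticTwist_two_mul_eq (p : Nat.Primes) (hp2 : (p : ℕ) ≠ 2) (hpℓ : p ≠ ⟨ℓ, hℓ.out⟩) :
    haveI := W.isElliptic_quadraticTwist (show (((2 : ℤ) * ℓ : ℤ) : ℚ) ≠ 0 by
      exact_mod_cast mul_ne_zero two_ne_zero (by exact_mod_cast hℓ.out.ne_zero))
    (W.quadraticTwist (((2 : ℤ) * ℓ : ℤ) : ℚ)).conductorExponent ((primesEquiv (R := ℤ)).symm p) =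
      W.conductorExponent ((primesEquiv (R := ℤ)).symm p) := by
  have hd0 : ((2 : ℤ) * ℓ : ℤ) ≠ 0 := mul_ne_zero two_ne_zero (by exact_mod_cast hℓ.out.ne_zero)
  haveI := W.isElliptic_quadraticTwist (show (((2 : ℤ) * ℓ : ℤ) : ℚ) ≠ 0 by exact_mod_cast hd0)
  set W' := W.quadraticTwist (((2 : ℤ) * ℓ : ℤ) : ℚ) with hW'
  have hp2' : p ≠ ⟨2, (Fact.out : Nat.Prime 2)⟩ := fun h ↦ hp2 (congrArg Subtype.val h)
  obtain ⟨hg, hm, ha⟩ := hasReductionAt_quadraticTwist_two_mul_iff W p hp2 hpℓ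
  rcases hasGoodReductionAt_or_hasMultiplicativeReductionAt_or_hasAdditiveReductionAt
    ((primesEquiv (R := ℤ)).symm p) W with h | h | h
  · rw [(conductorExponent_eq_zero_iff_holds _ W').mpr (hg.mpr h), (conductorExponent_eq_zero_iff_holds _ W).mpr h]
  · rw [(conductorExponent_eq_one_iff_holds _ W').mpr (hm.mpr h), (conductorExponent_eq_one_iff_holds _ W).mpr h]
  · rw [TwistTypeConductor.conductorExponent_eq_two_of_twistType_odd W' p hp2 (ha.mpr h)
        (fun _ ↦ twistType_quadraticTwist_of_not_dvd W htt _ p hp2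
          (by exact_mod_cast not_natGenerator_dvd_mul (q := 2) (ℓ := ℓ) p hp2' hpℓ) h),
      TwistTypeConductor.conductorExponent_eq_two_of_twistType_odd W p hp2 h (fun _ ↦ htt p hp2 h)]

variable [W.IsGloballyMinimal]

/-- **`N_{E^{(2ℓ)}} = 32 · N_E · ℓ²`** for `E` MULTIPLICATIVE at `2` and good at `ℓ ≥ 5`: `f₂(E^{(2ℓ)}) = 6`
(`conductorExponent_quadraticTwist_eq_six_of_hasMultiplicativeReductionAtPrime_two`, `2ℓ ≡ 2 (mod 4)`), `f₂(E) = 1`;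
`f_ℓ(E^{(2ℓ)}) = 2`, `f_ℓ(E) = 0`; equal exponents elsewhere (`conductorExponent_quadraticTwist_two_mul_eq`).
[cite: SilvermanATAEC1994, IV.10.2 and IV.11.1] -/
theorem conductorNorm_quadraticTwist_two_mul_eq (hℓ5 : 5 ≤ ℓ) (h2m : W.HasMultiplicativeReductionAtPrime 2)
    (hℓg : W.HasGoodReductionAtPrime ℓ) :
    (W.quadraticTwist (((2 : ℤ) * ℓ : ℤ) : ℚ)).conductorNorm ℤ = W.conductorNorm ℤ * 2 ^ 5 * ℓ ^ 2 := by
  have hℓ2 : ℓ ≠ 2 := by omega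
  have h2ℓ : (2 : ℕ) ≠ ℓ := fun h ↦ hℓ2 h.symm
  have hℓodd : (ℓ : ℤ) % 2 = 1 := by exact_mod_cast Nat.odd_iff.mp (hℓ.out.odd_of_ne_two hℓ2)
  have hd4 : ((2 : ℤ) * ℓ) % 4 = 2 := by omega
  have hd0 : ((2 : ℤ) * ℓ : ℤ) ≠ 0 := mul_ne_zero two_ne_zero (by exact_mod_cast hℓ.out.ne_zero)
  haveI := W.isElliptic_quadraticTwist (show (((2 : ℤ) * ℓ : ℤ) : ℚ) ≠ 0 by exact_mod_cast hd0)
  set W' := W.quadraticTwist (((2 : ℤ) * ℓ : ℤ) : ℚ) with hW'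
  set P2 : Nat.Primes := ⟨2, Nat.prime_two⟩
  set Pℓ : Nat.Primes := ⟨ℓ, hℓ.out⟩
  set N := W.conductorNorm ℤ with hN
  have hN0 : N ≠ 0 := (W.conductorNorm_pos_holds).ne'
  have hN'0 : W'.conductorNorm ℤ ≠ 0 := (W'.conductorNorm_pos_holds).ne'
  have hf2' : W'.conductorExponent ((primesEquiv (R := ℤ)).symm P2) = 6 := by
    have h := conductorExponent_quadraticTwist_eq_six_of_hasMultiplicativeReductionAtPrime_two W hd4 h2m
    exact h
  have hf2 : W.conductorExponent ((primesEquiv (R := ℤ)).symm P2) = 1 :=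
    (conductorExponent_eq_one_iff_holds _ W).mpr
      ((W.hasMultiplicativeReductionAtPrime_iff_hasMultiplicativeReductionAt_holds P2).mp h2m)
  have hfℓ' : W'.conductorExponent ((primesEquiv (R := ℤ)).symm Pℓ) = 2 :=
    Literature.NumberTheory.EllipticCurves.conductorExponent_eq_two_of_five_le_holds W' _ (by rw [natGenerator_symm']; exact hℓ5)
      (W.hasAdditiveReductionAt_quadraticTwist_mul_of_hasGoodReductionAtPrime hℓ2 h2ℓ hℓg)
  have hfℓ : W.conductorExponent ((primesEquiv (R := ℤ)).symm Pℓ) = 0 :=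
    (conductorExponent_eq_zero_iff_holds _ W).mpr ((W.hasGoodReductionAtPrime_iff_hasGoodReductionAt_holds Pℓ).mp hℓg)
  refine Nat.eq_of_factorization_eq hN'0 (mul_ne_zero (mul_ne_zero hN0 (by norm_num)) (pow_ne_zero _ hℓ.out.ne_zero))
    fun r ↦ ?_
  by_cases hr : r.Prime
  swap
  · rw [Nat.factorization_eq_zero_of_not_prime _ hr, Nat.factorization_eq_zero_of_not_prime _ hr]
  rw [Nat.factorization_mul (mul_ne_zero hN0 (by norm_num)) (pow_ne_zero _ hℓ.out.ne_zero),
    Nat.factorization_mul hN0 (by norm_num), Nat.factorization_pow, Nat.factorization_pow]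
  simp only [Finsupp.add_apply, Finsupp.smul_apply, Nat.prime_two.factorization, hℓ.out.factorization, smul_eq_mul]
  set R : Nat.Primes := ⟨r, hr⟩
  rw [show (W'.conductorNorm ℤ).factorization r = (W'.conductorNorm ℤ).factorization R from rfl,
    show N.factorization r = N.factorization R from rfl, factorization_conductorNorm_primesEquiv_symm W' R,
    factorization_conductorNorm_primesEquiv_symm W R]
  by_cases hr2 : r = 2
  · have hR : R = P2 := Subtype.ext hr2
    rw [hR, hf2', hf2]
    simp [hr2, h2ℓ]
  by_cases hrℓ : r = ℓ
  · have hR : R = Pℓ := Subtype.ext hrℓ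
    rw [hR, hfℓ', hfℓ]
    simp [hrℓ, hℓ2]
  rw [conductorExponent_quadraticTwist_two_mul_eq W htt R hr2 (fun h ↦ hrℓ (congrArg Subtype.val h))]
  simp [hr2, hrℓ]

omit [W.IsGloballyMinimal] in
/-- **The `hle` bound for the twist `W' = E^{(2ℓ)}`** (hypothesis of `atkinLehnerEigenvalueAt_eq_χ₄_of_twist_of_le`), `ℓ ≥ 5` good, for every
odd prime `p`: at the additive `2` equality (`p* ≡ 1 (mod 4)` does not move `f₂`), at `ℓ` both exponents are `2`, at the other odd additive
primes both are `2` (twist type transported). [cite: SilvermanATAEC1994, IV.9.4 and IV.10.2] -/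
theorem conductorExponent_pStar_quadraticTwist_two_mul_le (hℓ5 : 5 ≤ ℓ) (p : Nat.Primes) (hp2 : (p : ℕ) ≠ 2) :
    haveI := W.isElliptic_quadraticTwist (show (((2 : ℤ) * ℓ : ℤ) : ℚ) ≠ 0 by
      exact_mod_cast mul_ne_zero two_ne_zero (by exact_mod_cast hℓ.out.ne_zero))
    ∀ v : HeightOneSpectrum ℤ, natGenerator v ≠ p → (W.quadraticTwist (((2 : ℤ) * ℓ : ℤ) : ℚ)).HasAdditiveReductionAt v →
      ((W.quadraticTwist (((2 : ℤ) * ℓ : ℤ) : ℚ)).quadraticTwist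
          (((-1 : ℤ) ^ ((p : ℕ) / 2) * p : ℤ) : ℚ)).conductorExponent v ≤
        (W.quadraticTwist (((2 : ℤ) * ℓ : ℤ) : ℚ)).conductorExponent v := by
  set d : ℤ := (2 : ℤ) * ℓ with hd
  have hd0 : d ≠ 0 := mul_ne_zero two_ne_zero (by exact_mod_cast hℓ.out.ne_zero)
  haveI := W.isElliptic_quadraticTwist (show (d : ℚ) ≠ 0 by exact_mod_cast hd0)
  set W' := W.quadraticTwist (d : ℚ) with hW'
  set Pℓ : Nat.Primes := ⟨ℓ, hℓ.out⟩
  intro v hvp hadd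
  obtain ⟨r, rfl⟩ := (primesEquiv (R := ℤ)).symm.surjective v
  rw [natGenerator_symm'] at hvp
  have hrp : r ≠ p := fun h ↦ hvp (congrArg Subtype.val h)
  have hps0Z : ((-1 : ℤ) ^ ((p : ℕ) / 2) * p : ℤ) ≠ 0 := mul_ne_zero (pow_ne_zero _ (by norm_num)) (by exact_mod_cast p.2.ne_zero)
  haveI := W'.isElliptic_quadraticTwist (show (((-1 : ℤ) ^ ((p : ℕ) / 2) * p : ℤ) : ℚ) ≠ 0 by exact_mod_cast hps0Z)
  haveI := Fact.mk p.2
  by_cases hr2 : (r : ℕ) = 2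
  · exact (conductorExponent_quadraticTwist_eq_of_emod_four_eq_one W' r hr2 (pStar_emod_four p hp2)).le
  have hr2' : r ≠ ⟨2, (Fact.out : Nat.Prime 2)⟩ := fun h ↦ hr2 (congrArg Subtype.val h)
  have hD0' : d * ((-1 : ℤ) ^ ((p : ℕ) / 2) * p) ≠ 0 := mul_ne_zero hd0 hps0Z
  have keyD : W'.quadraticTwist (((-1 : ℤ) ^ ((p : ℕ) / 2) * p : ℤ) : ℚ) =
      W.quadraticTwist (((d * ((-1 : ℤ) ^ ((p : ℕ) / 2) * p)) : ℤ) : ℚ) := by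
    rw [hW', quadraticTwist_quadraticTwist]; push_cast; ring_nf
  -- `ℓ ≥ 5`, or an odd additive prime of `W` of twist type; both are `2`
  have hadd2 : (W'.quadraticTwist (((-1 : ℤ) ^ ((p : ℕ) / 2) * p : ℤ) : ℚ)).HasAdditiveReductionAt
      ((primesEquiv (R := ℤ)).symm r) :=
    ((W'.hasReductionAt_quadraticTwist_pStar_iff (p := (p : ℕ)) hp2 _ (by rw [natGenerator_symm']; exact hvp)).2.2).mpr hadd
  by_cases hrℓ : r = Pℓ
  · have hr5 : 5 ≤ (r : ℕ) := by rw [hrℓ]; exact hℓ5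
    rw [Literature.NumberTheory.EllipticCurves.conductorExponent_eq_two_of_five_le_holds _ _
        (by rw [natGenerator_symm']; exact hr5) hadd2,
      Literature.NumberTheory.EllipticCurves.conductorExponent_eq_two_of_five_le_holds W' _
        (by rw [natGenerator_symm']; exact hr5) hadd]
  have haddW : W.HasAdditiveReductionAt ((primesEquiv (R := ℤ)).symm r) :=
    (hasReductionAt_quadraticTwist_two_mul_iff W r hr2 hrℓ).2.2.mp hadd
  have hru : ¬ ((natGenerator ((primesEquiv (R := ℤ)).symm r) : ℕ) : ℤ) ∣ d * ((-1 : ℤ) ^ ((p : ℕ) / 2) * p) := by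
    intro h
    rcases (Nat.prime_iff_prime_int.mp (prime_natGenerator _)).dvd_or_dvd h with h | h
    · exact not_natGenerator_dvd_mul (q := 2) (ℓ := ℓ) r hr2' hrℓ (by rw [hd] at h; exact_mod_cast h)
    · rw [natGenerator_symm'] at h
      exact hrp (Subtype.ext ((Nat.prime_dvd_prime_iff_eq r.2 p.2).mp
        (Int.natCast_dvd_natCast.mp (((isUnit_neg_one (α := ℤ)).pow _).dvd_mul_left.mp h))))
  have htw1 : ¬ ((W'.quadraticTwist (((-1 : ℤ) ^ ((p : ℕ) / 2) * p : ℤ) : ℚ)).quadraticTwist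
      (((-1 : ℤ) ^ ((r : ℕ) / 2) * r : ℤ) : ℚ)).HasAdditiveReductionAt ((primesEquiv (R := ℤ)).symm r) := by
    rw [keyD]; exact twistType_quadraticTwist_of_not_dvd W htt _ r hr2 hru haddW
  have htw2 : ¬ (W'.quadraticTwist (((-1 : ℤ) ^ ((r : ℕ) / 2) * r : ℤ) : ℚ)).HasAdditiveReductionAt
      ((primesEquiv (R := ℤ)).symm r) := by
    rw [hW', hd]
    exact twistType_quadraticTwist_of_not_dvd W htt _ r hr2
      (by exact_mod_cast not_natGenerator_dvd_mul (q := 2) (ℓ := ℓ) r hr2' hrℓ) haddW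
  rw [TwistTypeConductor.conductorExponent_eq_two_of_twistType_odd _ r hr2 hadd2 (fun _ ↦ htw1),
    TwistTypeConductor.conductorExponent_eq_two_of_twistType_odd W' r hr2 hadd (fun _ ↦ htw2)]

end Conductor

end Summit.BirchSwinnertonDyer.BirchSwinnertonDyer.Theorems.TwistRootNumberDyadic

end
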